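import Summits.NavierStokesRegularity.FunctionalMining.VelocityL4SaturatingLaw
import HarnessLib

/-!
# FunctionalMining — the PURE `L⁴` law `d/dt ∫|u|⁴ ≤ c ν⁻⁷ (∫|u|⁴)³` on `T³` (K1-Q0, velocity
# moment `U₄`; Robinson–Rodrigo–Sadowski 2016 Ex. 11.4–11.7 shape, zero-mean torus version)

search for candidate a priori estimates; no regularity claim. Cell `pub-nsfunc`, prove seat
(gen 8). HONEST SCOPE: an a priori differential inequality with an EXISTENTIAL constant, closing
for small data / short time only; nothing about regularity.

K1-Q0 (DICTIONARY v1.6 / `dict/K1Q0-CLOSEOUT.md`) records the velocity moments `U_s = ∫|u|^s`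
(`s > 3`) as "LAW-SHAPED in print": `dU_s/dt ≤ c_s ν^{−(s+3)/(s−3)} U_s^{(s−1)/(s−3)}`
(Robinson–Rodrigo–Sadowski 2016, Ch. 11, Exercises 11.4–11.7, eq. (11.21); on the whole space the
homogeneous Sobolev inequality closes the chain). Here the case `s = 4` ON THE TORUS for zero-mean
classical solutions, where the inhomogeneous Sobolev embedding needs the nonlinear Poincaré
inequality of `VelocityL4NonlinearPoincare` (the linear one is false for `|u|²`):

* `velocityL4_pureLaw : ∃ c, IsRateBudget (fun v => ∫‖v‖⁴) (fun ν v => c (ν⁷)⁻¹ (∫‖v‖⁴)³)`.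

Chain (companion files): `U̇ ≤ −4νI + 4|∫|u|²⟪∇p,u⟫|` (`derivWithin_integral_norm_pow_four_le`),
`N² ≤ 16C_p²A₆I`, `A₆⁴ ≤ U³A₁₂`, `A₁₂ ≤ C₁₂I³` ⇒ `N⁸ ≤ (16C_p²)⁴C₁₂ U³I⁷`
(`production_pow_eight_le`; no `L⁶`-Sobolev bound on `u` itself is needed here), and Young at
`(8, 8/7)` (`le_of_pow_eight_le`). [ours; cf. RobinsonRodrigoSadowski2016 Ch. 11 Ex. 11.4–11.7]
-/

noncomputable section

open MeasureTheory Finset Set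
open scoped InnerProductSpace RealInnerProductSpace ContDiff

namespace Summit.NavierStokesRegularity.FunctionalMining

open Literature.Analysis.FunctionSpaces Literature.Analysis.FunctionSpaces.Torus
  Literature.Analysis.FluidPDE

namespace VelocityL4

variable {d : Type*} [Fintype d] [DecidableEq d]

/-- Polynomial bookkeeping for the pure law: `N² ≤ c₁A₆I`, `A₆⁴ ≤ U³A₁₂`, `A₁₂ ≤ c₃I³` give
`N⁸ ≤ c₁⁴c₃ U³ I⁷`. [ours; elementary] -/
theorem production_pow_eight_le {N A₆ A₁₂ U I c₁ c₃ : ℝ} (hU : 0 ≤ U)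
    (h1 : N ^ 2 ≤ c₁ * A₆ * I) (h3 : A₆ ^ 4 ≤ U ^ 3 * A₁₂) (h4 : A₁₂ ≤ c₃ * I ^ 3) :
    N ^ 8 ≤ c₁ ^ 4 * c₃ * U ^ 3 * I ^ 7 := by
  have h8 : N ^ 8 ≤ (c₁ * A₆ * I) ^ 4 := by
    have := pow_le_pow_left₀ (sq_nonneg N) h1 4
    rw [← pow_mul] at this
    exact this
  have h34 : A₆ ^ 4 ≤ U ^ 3 * (c₃ * I ^ 3) :=
    h3.trans (mul_le_mul_of_nonneg_left h4 (by positivity))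
  calc N ^ 8 ≤ (c₁ * A₆ * I) ^ 4 := h8
    _ = c₁ ^ 4 * A₆ ^ 4 * I ^ 4 := by ring
    _ ≤ c₁ ^ 4 * (U ^ 3 * (c₃ * I ^ 3)) * I ^ 4 := by gcongr
    _ = c₁ ^ 4 * c₃ * U ^ 3 * I ^ 7 := by ring

/-- **Young / AM–GM at the exponents `(8, 8/7)`**: `N⁸ ≤ x y⁷` with `N, x, y ≥ 0` gives
`N ≤ x/8 + 7y/8`. [folklore] -/
theorem le_of_pow_eight_le {N x y : ℝ} (hN : 0 ≤ N) (hx : 0 ≤ x) (hy : 0 ≤ y)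
    (h : N ^ 8 ≤ x * y ^ 7) : N ≤ x / 8 + 7 * y / 8 := by
  have h8 : N = (N ^ 8) ^ ((8 : ℕ)⁻¹ : ℝ) := (Real.pow_rpow_inv_natCast hN (by norm_num)).symm
  have hmono : (N ^ 8) ^ ((8 : ℕ)⁻¹ : ℝ) ≤ (x * y ^ 7) ^ ((8 : ℕ)⁻¹ : ℝ) :=
    Real.rpow_le_rpow (by positivity) h (by norm_num)
  have hsplit : (x * y ^ 7) ^ ((8 : ℕ)⁻¹ : ℝ) = x ^ (1 / 8 : ℝ) * y ^ (7 / 8 : ℝ) := by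
    rw [Real.mul_rpow hx (by positivity)]
    have e1 : ((8 : ℕ)⁻¹ : ℝ) = 1 / 8 := by norm_num
    rw [e1]
    congr 1
    rw [show y ^ 7 = y ^ ((7 : ℕ) : ℝ) from (Real.rpow_natCast y 7).symm, ← Real.rpow_mul hy]
    norm_num
  have hAG : x ^ (1 / 8 : ℝ) * y ^ (7 / 8 : ℝ) ≤ (1 / 8) * x + (7 / 8) * y :=
    Real.geom_mean_le_arith_mean2_weighted (by norm_num) (by norm_num) hx hy (by norm_num)
  rw [h8]
  calc (N ^ 8) ^ ((8 : ℕ)⁻¹ : ℝ) ≤ (x * y ^ 7) ^ ((8 : ℕ)⁻¹ : ℝ) := hmono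
    _ = x ^ (1 / 8 : ℝ) * y ^ (7 / 8 : ℝ) := hsplit
    _ ≤ (1 / 8) * x + (7 / 8) * y := hAG
    _ = x / 8 + 7 * y / 8 := by ring

/-- **Production bound for the pure law (static).** With a mean-zero Sobolev constant `C₆` (only
through `C₁₂ = 32(64C₆ + (1968d³)³)`) and the pressure-gradient constant `C_p`: for smooth
zero-mean `u` and smooth `p` with `‖∇p‖₂ ≤ C_p‖(u·∇)u‖₂`,
`(4|∫|u|²⟪∇p,u⟫|)⁸ ≤ (16C_p²)⁴ C₁₂ (∫|u|⁴)³ (∫|u|²∑ₖ‖∂ₖu‖²)⁷`. [ours] -/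
theorem production_bound_pure {C₆ Cp : ℝ} (hC₆0 : 0 ≤ C₆) (hCp0 : 0 ≤ Cp)
    (hC₆ : ∀ v : UnitAddTorus d → EuclideanSpace ℝ d, IsSmooth v → HasZeroMean v →
      ∫ x, ‖v x‖ ^ 6 ≤ C₆ * gradNormSq v ^ 3)
    {u : UnitAddTorus d → EuclideanSpace ℝ d} (hu : IsSmooth u) (h0 : HasZeroMean u)
    {p : UnitAddTorus d → ℝ} (hp : IsSmooth p)
    (hgrad : Real.sqrt (∫ x, ‖gradient p x‖ ^ 2) ≤
      Cp * Real.sqrt (∫ x, ‖convect u u x‖ ^ 2)) :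
    (4 * |∫ x, ‖u x‖ ^ 2 * ⟪gradient p x, u x⟫|) ^ 8 ≤
      (16 * Cp ^ 2) ^ 4 * (32 * (64 * C₆ + (1968 * (Fintype.card d : ℝ) ^ 3) ^ 3)) *
        (∫ x, ‖u x‖ ^ 4) ^ 3 * (∫ x, ‖u x‖ ^ 2 * ∑ k, ‖partialDeriv k u x‖ ^ 2) ^ 7 := by
  obtain ⟨I, hI⟩ : ∃ I : ℝ, I = ∫ x, ‖u x‖ ^ 2 * ∑ k, ‖partialDeriv k u x‖ ^ 2 := ⟨_, rfl⟩
  obtain ⟨U, hU⟩ : ∃ U : ℝ, U = ∫ x, ‖u x‖ ^ 4 := ⟨_, rfl⟩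
  obtain ⟨A₆, hA₆⟩ : ∃ A : ℝ, A = ∫ x, ‖u x‖ ^ 6 := ⟨_, rfl⟩
  obtain ⟨A₁₂, hA₁₂⟩ : ∃ A : ℝ, A = ∫ x, ‖u x‖ ^ 12 := ⟨_, rfl⟩
  obtain ⟨N, hN⟩ : ∃ N : ℝ, N = 4 * |∫ x, ‖u x‖ ^ 2 * ⟪gradient p x, u x⟫| := ⟨_, rfl⟩
  rw [← hI, ← hU, ← hN]
  have huc : Continuous u := hu.continuous
  have hI0 : 0 ≤ I := by rw [hI]; exact integral_nonneg fun x => by positivity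
  have hU0 : 0 ≤ U := by rw [hU]; exact integral_nonneg fun x => by positivity
  have hA0 : 0 ≤ A₆ := by rw [hA₆]; exact integral_nonneg fun x => by positivity
  have hN0 : 0 ≤ N := by rw [hN]; positivity
  have hconv : Real.sqrt (∫ x, ‖convect u u x‖ ^ 2) ≤ Real.sqrt I := by
    rw [hI]; exact Real.sqrt_le_sqrt (integral_norm_convect_self_sq_le hu)
  have hNle : N ≤ 4 * (Real.sqrt A₆ * (Cp * Real.sqrt I)) := by
    have h := abs_pressure_term_le hu hp
    rw [← hA₆] at h
    rw [hN]
    calc 4 * |∫ x, ‖u x‖ ^ 2 * ⟪gradient p x, u x⟫|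
        ≤ 4 * (Real.sqrt A₆ * Real.sqrt (∫ x, ‖gradient p x‖ ^ 2)) := by gcongr
      _ ≤ 4 * (Real.sqrt A₆ * (Cp * Real.sqrt I)) := by
          gcongr
          exact hgrad.trans (mul_le_mul_of_nonneg_left hconv hCp0)
  have h1 : N ^ 2 ≤ 16 * Cp ^ 2 * A₆ * I := by
    have hs := pow_le_pow_left₀ hN0 hNle 2
    have eA := Real.sq_sqrt hA0
    have eI := Real.sq_sqrt hI0
    calc N ^ 2 ≤ (4 * (Real.sqrt A₆ * (Cp * Real.sqrt I))) ^ 2 := hs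
      _ = 16 * Cp ^ 2 * (Real.sqrt A₆ ^ 2) * (Real.sqrt I ^ 2) := by ring
      _ = 16 * Cp ^ 2 * A₆ * I := by rw [eA, eI]
  have h3 : A₆ ^ 4 ≤ U ^ 3 * A₁₂ := by
    rw [hA₆, hU, hA₁₂]; exact integral_norm_pow_six_pow_four_le huc
  have h4 : A₁₂ ≤ 32 * (64 * C₆ + (1968 * (Fintype.card d : ℝ) ^ 3) ^ 3) * I ^ 3 := by
    rw [hA₁₂, hI]; exact integral_norm_pow_twelve_le hC₆0 hC₆ hu h0
  exact production_pow_eight_le hU0 h1 h3 h4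

/-- **The pure `L⁴` law on `T³` (K1-Q0, `U₄`), in the kernel.** There is a constant `c` such that
along every zero-mean classical solution of the unforced Navier–Stokes equations on `T³`
(`ν > 0`), at every time of the window, `s ↦ ∫‖u(s)‖⁴` is differentiable within the window and
`d/dt ∫‖u‖⁴ ≤ c · ν⁻⁷ · (∫‖u‖⁴)³` — the torus, zero-mean form of Robinson–Rodrigo–Sadowski 2016,
Ex. 11.4–11.7, eq. (11.21) at `s = 4` (whole space in print). Existential constant (Sobolev and
Calderón–Zygmund constants of the tree); an a priori inequality only.
[ours; cf. RobinsonRodrigoSadowski2016 Ch. 11 Ex. 11.4–11.7 (11.21)] -/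
theorem velocityL4_pureLaw :
    ∃ c : ℝ, IsRateBudget (d := d) (fun v => ∫ x, ‖v x‖ ^ 4)
      (fun ν v => c * (ν ^ 7)⁻¹ * (∫ x, ‖v x‖ ^ 4) ^ 3) := by
  classical
  by_cases hd : Fintype.card d = 3
  swap
  · exact ⟨0, fun h => absurd h hd⟩
  haveI : Nonempty d := Fintype.card_pos_iff.mp (by omega)
  obtain ⟨C₆, hC₆0, hC₆⟩ := Torus.exists_integral_norm_pow_six_le_gradNormSq_cube (d := d) hd
  obtain ⟨Cp, hCp0, hCp⟩ := Torus.exists_gradPressure_Ls_le_convect (d := d) (r := 2) one_lt_two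
  obtain ⟨K, hK⟩ : ∃ K : ℝ, K = (16 * Cp ^ 2) ^ 4 *
      (32 * (64 * C₆ + (1968 * (Fintype.card d : ℝ) ^ 3) ^ 3)) := ⟨_, rfl⟩
  have hK0 : 0 ≤ K := by rw [hK]; positivity
  refine ⟨K / 131072, ?_⟩
  intro _ ν hν a b hab u p hsol hmean t ht
  have hut : IsSmooth (u t) := hsol.smooth_velocity.isSmooth_slice ht
  have hpt : IsSmooth (p t) := hsol.smooth_pressure.isSmooth_slice ht
  have h0 : HasZeroMean (u t) := hmean t ht
  obtain ⟨hdiff, hle⟩ := derivWithin_integral_norm_pow_four_le hab hν.le hsol ht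
  refine ⟨hdiff, ?_⟩
  show _ ≤ K / 131072 * (ν ^ 7)⁻¹ * (∫ x, ‖u t x‖ ^ 4) ^ 3
  obtain ⟨I, hI⟩ : ∃ I : ℝ, I = ∫ x, ‖u t x‖ ^ 2 * ∑ k, ‖partialDeriv k (u t) x‖ ^ 2 := ⟨_, rfl⟩
  obtain ⟨U, hU⟩ : ∃ U : ℝ, U = ∫ x, ‖u t x‖ ^ 4 := ⟨_, rfl⟩
  obtain ⟨P, hP⟩ : ∃ P : ℝ, P = ∫ x, ‖u t x‖ ^ 2 * ⟪gradient (p t) x, u t x⟫ := ⟨_, rfl⟩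
  rw [← hI, ← hP] at hle
  rw [← hU]
  have hI0 : 0 ≤ I := by rw [hI]; exact integral_nonneg fun x => by positivity
  have hU0 : 0 ≤ U := by rw [hU]; exact integral_nonneg fun x => by positivity
  have hgrad : Real.sqrt (∫ x, ‖gradient (p t) x‖ ^ 2) ≤
      Cp * Real.sqrt (∫ x, ‖convect (u t) (u t) x‖ ^ 2) :=
    sqrt_integral_sq_le_of_rpow (f := fun x => ‖gradient (p t) x‖)
      (g := fun x => ‖convect (u t) (u t) x‖) (hCp hab hsol t ht)
  have h8 : (4 * |P|) ^ 8 ≤ K * U ^ 3 * I ^ 7 := by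
    rw [hK, hU, hI, hP]
    have h := production_bound_pure hC₆0 hCp0 hC₆ hut h0 hpt hgrad
    calc (4 * |∫ x, ‖u t x‖ ^ 2 * ⟪gradient (p t) x, u t x⟫|) ^ 8
        ≤ (16 * Cp ^ 2) ^ 4 * (32 * (64 * C₆ + (1968 * (Fintype.card d : ℝ) ^ 3) ^ 3)) *
          (∫ x, ‖u t x‖ ^ 4) ^ 3 * (∫ x, ‖u t x‖ ^ 2 * ∑ k, ‖partialDeriv k (u t) x‖ ^ 2) ^ 7 := h
      _ = _ := by ring
  -- Young: `4|P| ≤ x/8 + 7y/8`, `x = K U³/(4⁷ ν⁷)`, `y = 4νI`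
  obtain ⟨x, hx⟩ : ∃ x : ℝ, x = K * U ^ 3 / (16384 * ν ^ 7) := ⟨_, rfl⟩
  obtain ⟨y, hy⟩ : ∃ y : ℝ, y = 4 * ν * I := ⟨_, rfl⟩
  have hx0 : 0 ≤ x := by rw [hx]; positivity
  have hy0 : 0 ≤ y := by rw [hy]; positivity
  have hxy : x * y ^ 7 = K * U ^ 3 * I ^ 7 := by
    rw [hx, hy]; field_simp; ring
  have hNle : 4 * |P| ≤ x / 8 + 7 * y / 8 :=
    le_of_pow_eight_le (by positivity) hx0 hy0 (by rw [hxy]; exact h8)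
  have hbudget : K / 131072 * (ν ^ 7)⁻¹ * U ^ 3 = K * U ^ 3 / (131072 * ν ^ 7) := by
    field_simp
  rw [hbudget]
  have hxI : x / 8 + 7 * y / 8 = K * U ^ 3 / (131072 * ν ^ 7) + 7 / 2 * ν * I := by
    rw [hx, hy]; ring
  have hνI : 0 ≤ ν * I := mul_nonneg hν.le hI0
  linarith [hNle, hxI, hνI, hle]

end VelocityL4

end Summit.NavierStokesRegularity.FunctionalMining
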